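import Literature.AlgebraicGeometry.Frobenioids.Composites
import Literature.AlgebraicGeometry.Frobenioids.PreFrobenioidPullbacks
import Literature.AlgebraicGeometry.Frobenioids.ArchimedeanFrobeniusType
import HarnessLib

/-!
# Frobenioids II, Example 3.3 (ii): pull-back morphisms of `C₀`; [FrdI] Def. 1.3 (i)(a)(c), (iii)(a), (iv)(b), (v)(a), (vii)

Mochizuki, *The geometry of Frobenioids II: poly-Frobenioids*, Kyushu J. Math. **62** (2008)
401–460, §3, Example 3.3 (ii), author's text p. 28 ("a routine verification reveals that `C`
satisfies the conditions of [Mzk5], Definition 1.3") [cite: MochizukiFrdII2008, Ex 3.3 (ii) p.28];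
[FrdI] Def. 1.2 (ii) (pull-back morphisms), Def. 1.3 (i)(c), (iv)(b) (found's `Frobenioid.lean`).
PROOF-ONLY file (no definition) for abc-iut-L1-t6's `C₀ → F_{Φ₀}`.  Contents (all PROVED): a
morphism `(f, d, c)` of `C₀` is a pull-back morphism iff `d = 1` and `c · A_L = A_K|_L`
(`isPullbackMorphism_iff`); Def. 1.3 (i)(c) for `C₀`: `C₀^{pl-bk}_A → (D₀)_{A_D}` is an equivalence
(`i_c`), the lift of `Spec L → A_D` being `(Spec L, A|_L) → A`; Def. 1.3 (iv)(b) for `C₀`: pull-back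
morphisms are LB-invertible and linear (`iv_b`).  Then further clauses of [FrdI] Def. 1.3 for
`C₀`: (vii)(b) isotropy propagates along arrows
(`vii_b`); (vii)(a) isotropic hulls `(𝟙, 1, 1) : (K, B, λ) → (K, O_K^×, λ)` (`vii_a`); (i)(a) every
object of `D₀` carries the Frobenius-trivial object `(K, O_K^×, 1)` with `ζ(n) = (𝟙, n, 1)` (`i_a`);
(v)(a) pre-steps are monomorphisms (`v_a`); (iii)(a) co-angular morphisms are closed under
composition (`iii_a`, through the shadow calculus).
-/

namespace Literature.AlgebraicGeometry.Frobenioids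

open CategoryTheory Set Function Topology
open scoped Pointwise

noncomputable section

namespace ArchFrd

namespace C0

variable {X Y Z : C0}

/-! ### Pull-back morphisms in coordinates -/

/-- If `c · A_L = A_K|_L` then `|c| · tip(A_L) = tip(A_K)`. [cite: MochizukiFrdII2008, Ex 3.3 (i) p.28] -/
theorem norm_mul_tip_eq_of_full (φ : X ⟶ Y) (hd : degFr φ = 1)
    (hfull : scalar φ • X.region.carrier = pullRegion Y (Base φ)) :
    ‖(scalar φ : ℂ)‖ * X.tip = Y.tip := by
  obtain ⟨A', hA'c, hA't, -, -⟩ := exists_pulledRegion Y (Base φ)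
  refine le_antisymm ?_ ?_
  · have := norm_scalar_mul_tip_pow_le φ
    rwa [hd, PNat.one_coe, pow_one] at this
  · have h : (scalar φ)⁻¹ • A'.carrier ^ (0 + 1) ⊆ X.region.carrier := by
      rw [zero_add, pow_one, hA'c, ← hfull, smul_smul, inv_mul_cancel, one_smul]
    have h2 := ((A'.smul_carrier_pow_subset_iff X.region _ 0).1 h).2
    rw [A'.absHom_mul_pow_le_iff, zero_add, pow_one, hA't, Units.val_inv_eq_inv_val, norm_inv,
      ← tip_eq, ← tip_eq] at h2
    have hc : 0 < ‖(scalar φ : ℂ)‖ := norm_pos_iff.mpr (scalar φ).ne_zero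
    calc Y.tip = ‖(scalar φ : ℂ)‖ * (‖(scalar φ : ℂ)‖⁻¹ * Y.tip) := by
          rw [← mul_assoc, mul_inv_cancel₀ hc.ne', one_mul]
      _ ≤ ‖(scalar φ : ℂ)‖ * X.tip := mul_le_mul_of_nonneg_left h2 hc.le

/-- **Pull-back morphisms of `C₀`** ([FrdI] Def. 1.2 (ii): the natural transformation
`Hom(−, X) → Hom(−, Y) ×_{Hom(−, Y_D)} Hom(−, X_D)` is bijective): `φ = (f, d, c)` is a pull-back
morphism iff `d = 1` and `c · A_L = A_K|_L`. [cite: MochizukiFrdII2008, Ex 3.3 (ii) p.28] -/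
theorem isPullbackMorphism_iff (φ : X ⟶ Y) :
    PreFrobenioid.IsPullbackMorphism toElem φ ↔
      degFr φ = 1 ∧ scalar φ • X.region.carrier = pullRegion Y (Base φ) := by
  constructor
  · intro h
    -- test object: `(X.base, c⁻¹ · A_K|_f)` with the arrow `(f, 1, c)` to `Y` over `𝟙`
    obtain ⟨A', hA'c, hA't, hA'd, hA'i⟩ := exists_pulledRegion Y (Base φ)
    obtain ⟨A'', hA''d, hA''t⟩ := exists_angularRegion
      (isOpen_smul (unitPart ℂ (scalar φ)⁻¹) A'.isOpen_dir)
      (isConnected_smul (unitPart ℂ (scalar φ)⁻¹) A'.isConnected_dir) (absHom ℂ (scalar φ)⁻¹ * A'.tip)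
    have hA'' : (scalar φ)⁻¹ • A'.carrier ^ (0 + 1) = A''.carrier :=
      smul_carrier_pow_eq A' A'' _ 0 (by rw [zero_add, pow_one, hA''d]) (by rw [zero_add, pow_one, hA''t])
    rw [zero_add, pow_one] at hA''
    have hW : X.base = D0.real → A''.IsIsotropic := fun hX => by
      change A''.dir = univ
      rw [hA''d, show A'.dir = univ from
        hA'i (isNaivelyIsotropic_of_isRealObj (isRealObj_of_hom φ hX)), Set.smul_set_univ]
    let W : C0 := ⟨X.base, A'', hW⟩
    let g : W ⟶ Y :=
      { base := φ.base, degFr := 1, scalar := φ.scalar, scalar_mem := φ.scalar_mem,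
        mapsTo := by
          rw [PNat.one_coe, pow_one]
          change scalar φ • A''.carrier ⊆ pullRegion Y (Base φ)
          rw [← hA'', smul_smul, mul_inv_cancel, one_smul, hA'c] }
    obtain ⟨γ, hγ⟩ := (h W).2 ⟨(g, 𝟙 X.base), by
      change Base φ = 𝟙 X.base ≫ Base φ
      exact (Category.id_comp _).symm⟩
    have hγ1 : γ ≫ φ = g := congrArg (fun p : PreFrobenioid.PullbackHomData toElem φ W => p.1.1) hγ
    have hγ2 : Base γ = 𝟙 X.base :=
      congrArg (fun p : PreFrobenioid.PullbackHomData toElem φ W => p.1.2) hγ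
    have hdeg : degFr γ * degFr φ = 1 := by rw [← degFr_comp', hγ1]
    have hd : degFr φ = 1 := (PreFrobenioid.isLinear_factors toElem (β := γ) (α := φ) (by
      change degFr (γ ≫ φ) = 1; rw [hγ1])).1
    have hdγ : degFr γ = 1 := by rwa [hd, mul_one] at hdeg
    have hsc : scalar γ = 1 := by
      have := congrArg scalar hγ1
      rw [scalar_comp', hγ2, hd, PNat.one_coe, pow_one] at this
      change D0.galAct (D0.Hom.twists (𝟙 X.base)) (scalar φ) * scalar γ = scalar φ at this
      rw [D0.twists_id, D0.galAct_false] at this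
      exact mul_left_cancel (a := scalar φ) (this.trans (mul_one _).symm)
    refine ⟨hd, le_antisymm ?_ ?_⟩
    · have := φ.mapsTo
      change scalar φ • X.region.carrier ^ (degFr φ : ℕ) ⊆ _ at this
      rwa [hd, PNat.one_coe, pow_one] at this
    · have hm := γ.mapsTo
      change scalar γ • A''.carrier ^ (degFr γ : ℕ) ⊆ pullRegion X (Base γ) at hm
      rw [hsc, one_smul, hdγ, PNat.one_coe, pow_one, hγ2, pullRegion_id, ← hA'', hA'c] at hm
      exact Set.subset_smul_set_iff.mpr hm
  · rintro ⟨hd, hfull⟩ W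
    constructor
    · intro γ₁ γ₂ hγ
      have h1 : γ₁ ≫ φ = γ₂ ≫ φ :=
        congrArg (fun p : PreFrobenioid.PullbackHomData toElem φ W => p.1.1) hγ
      have h2 : Base γ₁ = Base γ₂ :=
        congrArg (fun p : PreFrobenioid.PullbackHomData toElem φ W => p.1.2) hγ
      have hdg : degFr γ₁ = degFr γ₂ := by
        have := congrArg degFr h1
        rw [degFr_comp', degFr_comp'] at this
        exact mul_right_cancel this
      refine hom_ext h2 hdg ?_
      have := congrArg scalar h1
      rw [scalar_comp', scalar_comp', h2, hd, PNat.one_coe, pow_one, pow_one] at this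
      exact mul_left_cancel this
    · rintro ⟨⟨g, b⟩, hgb⟩
      change W.base ⟶ X.base at b
      change Base g = b ≫ Base φ at hgb
      have hmem : scalar g * (b.act (scalar φ))⁻¹ ∈ D0.scalars W.base :=
        mul_mem g.scalar_mem (inv_mem (act_mem_scalars b φ.scalar_mem))
      have hmaps : (scalar g * (b.act (scalar φ))⁻¹) • W.region.carrier ^ (degFr g : ℕ) ⊆
          pullRegion X b := by
        have hg := g.mapsTo
        change scalar g • W.region.carrier ^ (degFr g : ℕ) ⊆ pullRegion Y (Base g) at hg
        rw [hgb, pullRegion_comp, ← hfull, act_image_smul] at hg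
        rw [mul_comm, mul_smul]
        exact Set.subset_smul_set_iff.mp hg
      let γ : W ⟶ X := ⟨b, degFr g, scalar g * (b.act (scalar φ))⁻¹, hmem, hmaps⟩
      refine ⟨γ, Subtype.ext (Prod.ext ?_ rfl)⟩
      change γ ≫ φ = g
      refine hom_ext hgb.symm ?_ ?_
      · change degFr g * degFr φ = degFr g
        rw [hd, mul_one]
      · change b.act (scalar φ) * (scalar g * (b.act (scalar φ))⁻¹) ^ (degFr φ : ℕ) = scalar g
        rw [hd, PNat.one_coe, pow_one, mul_comm, inv_mul_cancel_right]

/-! ### [FrdI] Def. 1.3 (i)(c) and (iv)(b) for `C₀` -/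

/-- **Def. 1.3 (i)(c) for `C₀`**: for every `A`, the functor `C₀^{pl-bk}_A → (D₀)_{A_D}` induced by the
projection is an equivalence — faithful and full formally (found's `PreFrobenioidPullbacks.lean`),
essentially surjective via the pull-back morphism `(f, 1, 1) : (Spec L, A_K|_L) → (Spec K, A_K)` over
any `f : Spec L → Spec K`. [cite: MochizukiFrdII2008, Ex 3.3 (ii) p.28] -/
theorem i_c (A : C0) : (PreFrobenioid.pullbackSliceToBase toElem A).IsEquivalence := by
  haveI := PreFrobenioid.pullbackSliceToBase_faithful toElem A
  haveI := PreFrobenioid.pullbackSliceToBase_full toElem A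
  haveI : (PreFrobenioid.pullbackSliceToBase toElem A).EssSurj := by
    refine ⟨fun T => ?_⟩
    -- `T.hom : T.left ⟶ A.base` in `D₀`; the object `(T.left, A|_{T.hom})`
    obtain ⟨A', hA'c, hA't, hA'd, hA'i⟩ := exists_pulledRegion A (T.hom : T.left ⟶ A.base)
    have hW : T.left = D0.real → A'.IsIsotropic := fun h => by
      have f : D0.real ⟶ A.base := by rw [← h]; exact T.hom
      exact hA'i (isNaivelyIsotropic_of_isRealObj (D0.eq_real_of_hom_real f))
    let W : C0 := ⟨T.left, A', hW⟩
    let π : W ⟶ A :=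
      { base := T.hom, degFr := 1, scalar := 1, scalar_mem := one_mem _,
        mapsTo := by rw [PNat.one_coe, pow_one, one_smul]; exact hA'c.subset }
    have hpb : PreFrobenioid.IsPullbackMorphism toElem π :=
      (isPullbackMorphism_iff π).2 ⟨rfl, by rw [one_smul]; exact hA'c⟩
    exact ⟨Over.mk (⟨π, hpb⟩ : (⟨W⟩ : PreFrobenioid.PullbackCat toElem) ⟶ ⟨A⟩),
      ⟨Over.isoMk (Iso.refl _) (Category.id_comp _)⟩⟩
  exact {}

/-- **Def. 1.3 (iv)(b) for `C₀`**: a pull-back morphism is LB-invertible (co-angular and isometric)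
and linear. [cite: MochizukiFrdII2008, Ex 3.3 (ii) p.28] -/
theorem iv_b (φ : X ⟶ Y) (h : PreFrobenioid.IsPullbackMorphism toElem φ) :
    PreFrobenioid.IsLBInvertible toElem φ ∧ PreFrobenioid.IsLinear toElem φ := by
  obtain ⟨hd, hfull⟩ := (isPullbackMorphism_iff φ).1 h
  refine ⟨⟨isCoAngular_of_isNaivelyCoAngular φ fun _ => ?_, ?_⟩, hd⟩
  · unfold Hom.image
    change unitPart ℂ '' (scalar φ • X.region.carrier ^ (degFr φ : ℕ)) = _
    rw [hd, PNat.one_coe, pow_one, hfull]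
  · rw [isIsometry_iff, hd, PNat.one_coe, pow_one]
    exact norm_mul_tip_eq_of_full φ hd hfull


/-! ### Twists of angular parts -/

/-- The twist of the whole circle is the whole circle. [cite: MochizukiFrdII2008, Def 3.1 (iv) p.24] -/
theorem twist_image_univ {L K : D0} (f : L ⟶ K) :
    (fun z : normOneSubgroup ℂ => unitPart ℂ (f.act (z : ℂˣ))) '' univ = univ :=
  Set.eq_univ_of_forall fun z => ⟨unitPart ℂ (f.act (z : ℂˣ)), trivial, twist_twist f z⟩

/-- The twist of a product set. [cite: MochizukiFrdII2008, Def 3.1 (iv) p.24] -/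
theorem twist_image_mul {L K : D0} (f : L ⟶ K) (B₁ B₂ : Set (normOneSubgroup ℂ)) :
    (fun z : normOneSubgroup ℂ => unitPart ℂ (f.act (z : ℂˣ))) '' (B₁ * B₂) =
      (fun z : normOneSubgroup ℂ => unitPart ℂ (f.act (z : ℂˣ))) '' B₁ *
        (fun z : normOneSubgroup ℂ => unitPart ℂ (f.act (z : ℂˣ))) '' B₂ := by
  ext z
  simp only [Set.mem_image, Set.mem_mul]
  constructor
  · rintro ⟨_, ⟨v, hv, w, hw, rfl⟩, rfl⟩
    exact ⟨_, ⟨v, hv, rfl⟩, _, ⟨w, hw, rfl⟩, (twist_mul f v w).symm⟩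
  · rintro ⟨_, ⟨v, hv, rfl⟩, _, ⟨w, hw, rfl⟩, rfl⟩
    exact ⟨v * w, ⟨v, hv, w, hw, rfl⟩, twist_mul f v w⟩

/-- The twist of a power set. [cite: MochizukiFrdII2008, Def 3.1 (iv) p.24] -/
theorem twist_image_pow {L K : D0} (f : L ⟶ K) (B : Set (normOneSubgroup ℂ)) : ∀ n : ℕ,
    (fun z : normOneSubgroup ℂ => unitPart ℂ (f.act (z : ℂˣ))) '' (B ^ (n + 1)) =
      ((fun z : normOneSubgroup ℂ => unitPart ℂ (f.act (z : ℂˣ))) '' B) ^ (n + 1)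
  | 0 => by rw [zero_add, pow_one, pow_one]
  | n + 1 => by rw [pow_succ, pow_succ _ (n + 1), twist_image_mul, twist_image_pow f B n]

/-- A twist covers the circle only if the set does. [cite: MochizukiFrdII2008, Def 3.1 (iv) p.24] -/
theorem eq_univ_of_twist_image_eq_univ {L K : D0} (f : L ⟶ K) {B : Set (normOneSubgroup ℂ)}
    (h : (fun z : normOneSubgroup ℂ => unitPart ℂ (f.act (z : ℂˣ))) '' B = univ) : B = univ := by
  refine Set.eq_univ_of_forall fun z => ?_
  obtain ⟨b, hb, hbz⟩ := (Set.eq_univ_iff_forall.mp h) (unitPart ℂ (f.act (z : ℂˣ)))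
  rwa [← twist_injective f hbz]

/-! ### Def. 1.3 (vii): isotropic objects and hulls -/

/-- **Def. 1.3 (vii)(b) for `C₀`**: if `A → B` and `A` is isotropic then so is `B` (the angular image
`(c/|c|) · (O^×)^d = O^×` must fit inside the twisted angular part of `B`).
[cite: MochizukiFrdII2008, Ex 3.3 (ii) p.28] -/
theorem vii_b (φ : X ⟶ Y) (hX : PreFrobenioid.IsIsotropic toElem X) :
    PreFrobenioid.IsIsotropic toElem Y := by
  rw [isIsotropic_iff_isNaivelyIsotropic] at hX ⊢
  obtain ⟨A', hA'c, -, hA'd, -⟩ := exists_pulledRegion Y (Base φ)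
  have h := (hom_conditions φ hA'c).1
  rw [show X.region.dir = univ from hX, Set.univ_pow (PNat.ne_zero _), Set.smul_set_univ,
    Set.univ_subset_iff, hA'd] at h
  exact eq_univ_of_twist_image_eq_univ (Base φ) h

/-- **Def. 1.3 (vii)(a) for `C₀`**: every object `A = (K, B, λ)` has an isotropic hull, namely
`(𝟙, 1, 1) : A → (K, O_K^×, λ)`: an isometric pre-step to an isotropic object through which every arrow
to an isotropic object factors uniquely (with the same data `(f, d, c)`).
[cite: MochizukiFrdII2008, Ex 3.3 (ii) p.28] -/
theorem vii_a (X : C0) : ∃ (Y : C0) (φ : X ⟶ Y), PreFrobenioid.IsIsotropicHull toElem φ := by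
  obtain ⟨A, hAd, hAt⟩ := exists_angularRegion isOpen_univ isConnected_univ_normOne X.region.tip
  let Y : C0 := ⟨X.base, A, fun _ => hAd⟩
  obtain ⟨A', hA'c, hA't, -, hA'i⟩ := exists_pulledRegion Y (𝟙 X.base)
  have hA'd : A'.dir = univ := hA'i hAd
  obtain ⟨φ, hφb, hφd, hφc⟩ := exists_hom X Y (𝟙 X.base) 1 (one_mem _) hA'c
    (by rw [hA'd]; exact Set.subset_univ _)
    (by
      rw [hA't, Units.val_one, norm_one, one_mul, PNat.one_coe, pow_one]
      change X.tip ≤ ((A.tip : PosReal) : ℝ); rw [hAt]; exact le_rfl)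
  refine ⟨Y, φ, ?_, ⟨hφd, by rw [isBaseIso_iff, hφb]; infer_instance⟩,
    isIsotropic_of_isNaivelyIsotropic hAd, fun W γ hW => ?_⟩
  · rw [isIsometry_iff, hφc, hφd, Units.val_one, norm_one, one_mul, PNat.one_coe, pow_one]
    change X.tip = ((A.tip : PosReal) : ℝ); rw [hAt]; rfl
  · -- factor `γ = (f, d, c)` through `φ` as `(f, d, c) : Y → W`
    have hWn : W.IsNaivelyIsotropic := (isIsotropic_iff_isNaivelyIsotropic W).1 hW
    obtain ⟨A'', hA''c, hA''t, -, hA''i⟩ := exists_pulledRegion W (Base (X := X) (Y := W) γ)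
    obtain ⟨β, hβb, hβd, hβc⟩ := exists_hom Y W (Base (X := X) (Y := W) γ) (degFr γ) γ.scalar_mem
      hA''c (by rw [show A''.dir = univ from hA''i hWn]; exact Set.subset_univ _)
      (by
        rw [hA''t]
        change ‖(scalar γ : ℂ)‖ * ((A.tip : PosReal) : ℝ) ^ (degFr γ : ℕ) ≤ W.tip
        rw [hAt]; exact norm_scalar_mul_tip_pow_le γ)
    refine ⟨β, hom_ext ?_ ?_ ?_, fun β' hβ' => hom_ext ?_ ?_ ?_⟩
    · rw [base_comp', hφb, hβb, Category.id_comp]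
    · rw [degFr_comp', hφd, hβd, one_mul]
    · rw [scalar_comp', hφb, hφc, hβc, one_pow, mul_one]
      change D0.galAct (D0.Hom.twists (𝟙 X.base)) (scalar γ) = scalar γ
      rw [D0.twists_id, D0.galAct_false]
    · have := congrArg Base hβ'
      rw [base_comp', hφb, Category.id_comp] at this
      rw [this, hβb]
    · have := congrArg degFr hβ'
      rw [degFr_comp', hφd, one_mul] at this
      rw [this, hβd]
    · have := congrArg scalar hβ'
      rw [scalar_comp', hφb, hφc, one_pow, mul_one] at this
      change D0.galAct (D0.Hom.twists (𝟙 X.base)) (scalar β') = scalar γ at this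
      rw [D0.twists_id, D0.galAct_false] at this
      rw [this, hβc]

/-! ### Def. 1.3 (i)(a): Frobenius-trivial objects -/

/-- **Def. 1.3 (i)(a) for `C₀`**: over every `Spec K ∈ Ob(D₀)` the object `(K, O_K^×, 1)` is
Frobenius-trivial, with `ζ(n) = (𝟙, n, 1)` (base-identity endomorphisms of Frobenius type of every
degree forming a monoid homomorphism). [cite: MochizukiFrdII2008, Ex 3.3 (ii) p.28] -/
theorem i_a (K : D0) :
    ∃ A : C0, PreFrobenioid.IsFrobeniusTrivial toElem A ∧ Nonempty (PreFrobenioid.baseObj toElem A ≅ K) := by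
  obtain ⟨A, hAd, hAt⟩ := exists_angularRegion isOpen_univ isConnected_univ_normOne 1
  let X : C0 := ⟨K, A, fun _ => hAd⟩
  -- the carrier is stable under powers: `(O^× × (0,1])^n = O^× × (0,1]`
  have hmaps : ∀ n : ℕ+, (1 : ℂˣ) • X.region.carrier ^ (n : ℕ) ⊆ pullRegion X (𝟙 K) := by
    intro n
    rw [pullRegion_id, ← n.natPred_add_one, A.smul_carrier_pow_subset_iff A 1 n.natPred, hAd,
      Set.univ_pow (Nat.succ_ne_zero _), unitPart_one, one_smul, map_one, one_mul, hAt, one_pow]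
    exact ⟨subset_rfl, le_rfl⟩
  let ζ : ℕ+ → (X ⟶ X) := fun n => ⟨𝟙 K, n, 1, one_mem _, hmaps n⟩
  have hζb : ∀ n, Base (ζ n) = 𝟙 K := fun n => rfl
  have hζd : ∀ n, degFr (ζ n) = n := fun n => rfl
  have hζc : ∀ n, scalar (ζ n) = 1 := fun n => rfl
  let ζ' : ℕ+ →* End X :=
    { toFun := ζ
      map_one' := hom_ext (hζb 1) (hζd 1) (hζc 1)
      map_mul' := fun m n => by
        change ζ (m * n) = ζ n ≫ ζ m
        refine hom_ext ?_ ?_ ?_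
        · change 𝟙 K = 𝟙 K ≫ 𝟙 K
          exact (Category.id_comp _).symm
        · change m * n = n * m
          exact mul_comm m n
        · change (1 : ℂˣ) = (𝟙 K : K ⟶ K).act 1 * 1 ^ (m : ℕ)
          rw [map_one, one_pow, mul_one] }
  refine ⟨X, ⟨ζ', fun n => ⟨hζd n, hζb n, (isFrobeniusType_iff _).2 ⟨fun _ => ?_, ?_, ?_⟩⟩⟩,
    ⟨Iso.refl _⟩⟩
  · change unitPart ℂ '' Hom.image (ζ n) = unitPart ℂ '' pullRegion X (Base (ζ n))
    rw [image_unitPart_homImage, image_unitPart_pullRegion, hζc, hζd, hζb, unitPart_one, one_smul,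
      twist_id_image]
    change A.dir ^ (n : ℕ) = A.dir
    rw [hAd, Set.univ_pow (PNat.ne_zero _)]
  · change ‖((scalar (ζ n) : ℂˣ) : ℂ)‖ * X.tip ^ (degFr (ζ n) : ℕ) = X.tip
    rw [hζc, hζd, Units.val_one, norm_one, one_mul]
    change ((A.tip : PosReal) : ℝ) ^ (n : ℕ) = ((A.tip : PosReal) : ℝ)
    rw [hAt, Positive.val_one, one_pow]
  · change IsIso (Base (ζ n)); rw [hζb]; infer_instance

/-! ### Def. 1.3 (v)(a): pre-steps are monomorphisms -/

/-- **Def. 1.3 (v)(a) for `C₀`**: a pre-step `(f, 1, c)` (`f` invertible) is a monomorphism — cancel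
`f`, the degrees and the scalar. [cite: MochizukiFrdII2008, Ex 3.3 (ii) p.28] -/
theorem v_a (φ : X ⟶ Y) (h : PreFrobenioid.IsPreStep toElem φ) : Mono φ := by
  haveI : IsIso (Base φ) := h.2
  refine ⟨fun γ₁ γ₂ e => ?_⟩
  have hb : Base γ₁ = Base γ₂ := by
    have := congrArg Base e
    rw [base_comp', base_comp'] at this
    exact (cancel_mono (Base φ)).mp this
  have hd : degFr γ₁ = degFr γ₂ := by
    have := congrArg degFr e
    rw [degFr_comp', degFr_comp'] at this
    exact mul_right_cancel this
  refine hom_ext hb hd ?_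
  have := congrArg scalar e
  rw [scalar_comp', scalar_comp', hb, show degFr φ = 1 from h.1, PNat.one_coe, pow_one, pow_one]
    at this
  exact mul_left_cancel this

/-! ### Def. 1.3 (iii)(a): co-angular morphisms compose -/

/-- Naively co-angular morphisms compose (shadow calculus). [cite: MochizukiFrdII2008, Ex 3.3 (ii) p.28] -/
theorem isNaivelyCoAngular_comp (φ : X ⟶ Y) (ψ : Y ⟶ Z) (hφ : IsNaivelyCoAngular φ)
    (hψ : IsNaivelyCoAngular ψ) : IsNaivelyCoAngular (φ ≫ ψ) := by
  intro hX
  have hdψ : (degFr ψ : ℕ) = (degFr ψ).natPred + 1 := (PNat.natPred_add_one _).symm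
  rw [homImage_comp, image_unitPart_smul, hdψ, image_unitPart_pow, hφ hX, shadow_pullRegion_comp,
    image_unitPart_pullRegion Y (Base φ), ← twist_image_pow, unitPart_galAct, ← twist_image_smul,
    ← hdψ]
  congr 1
  rcases D0.isReal_or_isComplex Y.base with hY | hY
  · -- `Y` real: both sides are the whole circle
    have hZ : Z.IsRealObj := isRealObj_of_hom ψ hY
    rw [show Y.region.dir = univ from isNaivelyIsotropic_of_isRealObj hY, Set.univ_pow (PNat.ne_zero _),
      Set.smul_set_univ, image_unitPart_pullRegion,
      show Z.region.dir = univ from isNaivelyIsotropic_of_isRealObj hZ, twist_image_univ]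
  · rw [← image_unitPart_homImage, hψ hY]

/-- **Def. 1.3 (iii)(a) for `C₀`**: co-angular morphisms are closed under composition.
[cite: MochizukiFrdII2008, Ex 3.3 (ii) p.28] -/
theorem iii_a (φ : X ⟶ Y) (ψ : Y ⟶ Z) (hφ : PreFrobenioid.IsCoAngular toElem φ)
    (hψ : PreFrobenioid.IsCoAngular toElem ψ) : PreFrobenioid.IsCoAngular toElem (φ ≫ ψ) := by
  rw [isCoAngular_iff_isNaivelyCoAngular] at hφ hψ ⊢
  exact isNaivelyCoAngular_comp φ ψ hφ hψ

end C0

end ArchFrd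

end

end Literature.AlgebraicGeometry.Frobenioids
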